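import Literature.Analysis.ValidatedNumerics.TaylorModelExpr
import Literature.Analysis.ValidatedNumerics.TaylorModelExp
import Literature.Analysis.ValidatedNumerics.KernelData
import Literature.MathematicalPhysics.QuantumFieldTheory.ConformalBootstrap3D.BlockExistenceLimit
import Literature.MathematicalPhysics.QuantumFieldTheory.ConformalBootstrap3D.PointKernel

/-!
# Taylor models in `Δ` for the Hogervorst–Rychkov coefficients `A_{n,j}(Δ)`

On a cell `Δ = A + ρ`, `|ρ| ≤ h = 2^{-e}`, every recursion coefficient `ρ ↦ A_{n,j}(A+ρ)` of the
`z`-series of a 3D scalar block (`hrCoeff`, Hogervorst–Rychkov 2013 eq. (3.9)) is enclosed in a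
TAYLOR MODEL of degree `D` with fixed-point interval coefficients (`PolyMP.TMem S h`, scale `S`):
the recursion `A_{n+1,j} = (γ⁺ A_{n,j-1} + γ⁻ A_{n,j+1}) / pivot` is run on Taylor models — the
`γ^±` are exact quadratics in `ρ`, the Casimir pivot is exact linear `p₀ + p₁ρ`, and the division is
SYNTHETIC DIVISION `b₀ = ν₀/p₀`, `b_{k+1} = (ν_{k+1} - p₁ b_k)/p₀` with the exact remainder identity
`(p₀ + p₁ρ)·B(ρ) = Σ_{k ≤ D} ν_k ρ^k + p₁ b_D ρ^{D+1}` (`sd_identity`) and the bound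
`|A - B| ≤ h^{D+1}(|ν_{D+1} - p₁ b_D| + |ν_{D+2}| h)/(|p₀| - |p₁| h)` folded into `b₀`
(`tmem_entry`). The exceptional pair `(1, ℓ-1)` (a `0/0` at the unitarity bound) is the exact linear
model of `hrCoeff_one_pred_eq`; off the descendant range the model is `[]` (= 0). `rows` tabulates
levels `0 … nF`; `rows_sound` is the enclosure theorem, under the kernel-checkable pivot condition
`pivOK` (`0 < |p₀| - |p₁| h` for every pair). This is the coefficient half of the point-functional
kernel v3 (node moments and the power sandwich are in `PointFunctionalTM`). Statements are folklore
validated numerics (Taylor-model arithmetic, Makino–Berz) applied to [HogervorstRychkov2013, §3 eq. (3.9)].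
-/

namespace Literature.MathematicalPhysics.QuantumFieldTheory.ConformalBootstrap3D

open Literature.Analysis.ValidatedNumerics Literature.Analysis.ValidatedNumerics.PolyMP
open Literature.Analysis.ValidatedNumerics.NumericsMP
open Finset
open PointKernel (mulQ mem_mulQ)

namespace HRTM

/-! ### A. Scalars: interval × exact rational, coefficient access, quadratic convolution -/

/-- The thin zero interval. [folklore] -/
def zI : MI := ⟨0, 0⟩

/-- [folklore] -/
theorem mem_zI (S : ℕ) : MI.mem S 0 zI := by simp [MI.mem, zI]

/-- Coefficient `k` of an interval polynomial (`0` beyond the end). [folklore] -/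
def cf (P : IPoly) (k : ℕ) : MI := P.getD k zI

/-- [folklore] -/
theorem mem_cf {S : ℕ} {as : List ℝ} {P : IPoly} (h : PMem S as P) :
    ∀ k : ℕ, MI.mem S (as.getD k 0) (cf P k) := by
  induction h with
  | nil => intro k; simpa [cf] using mem_zI S
  | cons ha _ ih =>
      intro k
      cases k with
      | zero => simpa [cf] using ha
      | succ k => simpa [cf] using ih k

/-- Coefficient `k` of `(g₀ + g₁ρ + g₂ρ²)·P(ρ)` for an exact quadratic. [folklore] -/
def conv3 (g0 g1 g2 : ℚ) (P : IPoly) (k : ℕ) : MI :=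
  let t0 := mulQ (cf P k) g0
  let t1 := if 1 ≤ k then MI.add t0 (mulQ (cf P (k - 1)) g1) else t0
  if 2 ≤ k then MI.add t1 (mulQ (cf P (k - 2)) g2) else t1

/-- Real shadow of `conv3`. [folklore] -/
noncomputable def conv3R (g0 g1 g2 : ℚ) (as : List ℝ) (k : ℕ) : ℝ :=
  as.getD k 0 * g0 + (if 1 ≤ k then as.getD (k - 1) 0 * g1 else 0) +
    (if 2 ≤ k then as.getD (k - 2) 0 * g2 else 0)

/-- [folklore] -/
theorem mem_conv3 {S : ℕ} {as : List ℝ} {P : IPoly} (h : PMem S as P) (g0 g1 g2 : ℚ) (k : ℕ) :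
    MI.mem S (conv3R g0 g1 g2 as k) (conv3 g0 g1 g2 P k) := by
  unfold conv3 conv3R
  by_cases h1 : 1 ≤ k
  · by_cases h2 : 2 ≤ k
    · simp only [h1, h2, if_true]
      exact MI.mem_add (MI.mem_add (mem_mulQ (mem_cf h k) g0) (mem_mulQ (mem_cf h _) g1))
        (mem_mulQ (mem_cf h _) g2)
    · simp only [h1, h2, if_true, if_false, add_zero]
      exact MI.mem_add (mem_mulQ (mem_cf h k) g0) (mem_mulQ (mem_cf h _) g1)
  · have h2 : ¬ 2 ≤ k := by omega
    simp only [h1, h2, if_false, add_zero]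
    exact mem_mulQ (mem_cf h k) g0

/-- `Σ_{k<K} a_k ρ^k = a(ρ)` once `K ≥ |a|`. [folklore] -/
theorem sum_getD_eq_evalR (ρ : ℝ) : ∀ (as : List ℝ) (K : ℕ), as.length ≤ K →
    ∑ k ∈ range K, as.getD k 0 * ρ ^ k = evalR as ρ
  | [], K, _ => by simp
  | a :: as, 0, hK => by simp at hK
  | a :: as, K + 1, hK => by
      rw [sum_range_succ', evalR_cons]
      simp only [List.getD_cons_succ, List.getD_cons_zero, pow_zero, mul_one, pow_succ]
      have ih := sum_getD_eq_evalR ρ as K (by simpa using hK)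
      rw [← ih, mul_sum, add_comm]
      congr 1
      exact sum_congr rfl fun k _ => by ring

/-- Index shift by one. [folklore] -/
theorem sum_shift1 (c : ℕ → ℝ) (ρ : ℝ) : ∀ K : ℕ,
    ∑ k ∈ range (K + 1), (if 1 ≤ k then c (k - 1) else 0) * ρ ^ k = ρ * ∑ k ∈ range K, c k * ρ ^ k
  | 0 => by simp
  | K + 1 => by
      rw [sum_range_succ, sum_shift1 c ρ K, sum_range_succ, if_pos (by omega), Nat.add_sub_cancel, mul_add]
      ring

/-- Index shift by two. [folklore] -/
theorem sum_shift2 (c : ℕ → ℝ) (ρ : ℝ) : ∀ K : ℕ,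
    ∑ k ∈ range (K + 2), (if 2 ≤ k then c (k - 2) else 0) * ρ ^ k = ρ ^ 2 * ∑ k ∈ range K, c k * ρ ^ k
  | 0 => by simp [sum_range_succ]
  | K + 1 => by
      rw [sum_range_succ, sum_shift2 c ρ K, sum_range_succ, if_pos (by omega), show K + 2 - 2 = K by omega,
        mul_add]
      ring

/-- The quadratic convolution evaluates to the product. [folklore] -/
theorem sum_conv3R (g0 g1 g2 : ℚ) (as : List ℝ) (ρ : ℝ) {K : ℕ} (hK : as.length + 2 ≤ K) :
    ∑ k ∈ range K, conv3R g0 g1 g2 as k * ρ ^ k =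
      ((g0 : ℝ) + g1 * ρ + g2 * ρ ^ 2) * evalR as ρ := by
  obtain ⟨K₂, rfl⟩ : ∃ K₂, K = K₂ + 2 := ⟨K - 2, by omega⟩
  have e0 : ∑ k ∈ range (K₂ + 2), as.getD k 0 * (g0 : ℝ) * ρ ^ k = g0 * evalR as ρ := by
    rw [← sum_getD_eq_evalR ρ as (K₂ + 2) (by omega), mul_sum]
    exact sum_congr rfl fun k _ => by ring
  have e1 : ∑ k ∈ range (K₂ + 2), (if 1 ≤ k then as.getD (k - 1) 0 * (g1 : ℝ) else 0) * ρ ^ k =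
      g1 * ρ * evalR as ρ := by
    rw [sum_shift1 (fun i => as.getD i 0 * (g1 : ℝ)) ρ (K₂ + 1),
      ← sum_getD_eq_evalR ρ as (K₂ + 1) (by omega), mul_sum, mul_sum]
    exact sum_congr rfl fun k _ => by ring
  have e2 : ∑ k ∈ range (K₂ + 2), (if 2 ≤ k then as.getD (k - 2) 0 * (g2 : ℝ) else 0) * ρ ^ k =
      g2 * ρ ^ 2 * evalR as ρ := by
    rw [sum_shift2 (fun i => as.getD i 0 * (g2 : ℝ)) ρ K₂,
      ← sum_getD_eq_evalR ρ as K₂ (by omega), mul_sum, mul_sum]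
    exact sum_congr rfl fun k _ => by ring
  simp only [conv3R, add_mul, sum_add_distrib, e0, e1, e2]

/-! ### B. Synthetic division by the linear pivot -/

/-- Quotient coefficients of `ν(ρ) / (p₀ + p₁ρ)`: `b₀ = ν₀/p₀`, `b_{k+1} = (ν_{k+1} - p₁ b_k)/p₀`
(real shadow). [folklore] -/
noncomputable def bR (ν : ℕ → ℝ) (p0 p1 : ℝ) : ℕ → ℝ
  | 0 => ν 0 / p0
  | k + 1 => (ν (k + 1) - p1 * bR ν p0 p1 k) / p0

/-- Interval quotient coefficients (specification; the kernel uses `bList`). [folklore] -/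
def bI (num : ℕ → MI) (p0 p1 : ℚ) : ℕ → MI
  | 0 => mulQ (num 0) (1 / p0)
  | k + 1 => mulQ (MI.sub (num (k + 1)) (mulQ (bI num p0 p1 k) p1)) (1 / p0)

/-- [folklore] -/
theorem mem_bI {S : ℕ} {ν : ℕ → ℝ} {num : ℕ → MI} (hν : ∀ k, MI.mem S (ν k) (num k))
    (p0 p1 : ℚ) : ∀ k, MI.mem S (bR ν p0 p1 k) (bI num p0 p1 k)
  | 0 => by
      have h := mem_mulQ (hν 0) (1 / p0)
      have e : bR ν p0 p1 0 = ν 0 * ((1 / p0 : ℚ) : ℝ) := by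
        simp only [bR]; push_cast; ring
      rw [e]; exact h
  | k + 1 => by
      have h := mem_mulQ (MI.mem_sub (hν (k + 1)) (mem_mulQ (mem_bI hν p0 p1 k) p1)) (1 / p0)
      have e : bR ν p0 p1 (k + 1) = (ν (k + 1) - bR ν p0 p1 k * (p1 : ℝ)) * ((1 / p0 : ℚ) : ℝ) := by
        simp only [bR]; push_cast; ring
      rw [e]; exact h

/-- Memoised quotient coefficients `[b_k, …, b_0]` (newest first). [folklore] -/
def bList (num : ℕ → MI) (p0 p1 : ℚ) : ℕ → List MI
  | 0 => [mulQ (num 0) (1 / p0)]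
  | k + 1 =>
      let prev := bList num p0 p1 k
      mulQ (MI.sub (num (k + 1)) (mulQ (prev.headD zI) p1)) (1 / p0) :: prev

/-- [folklore] -/
theorem bList_eq (num : ℕ → MI) (p0 p1 : ℚ) :
    ∀ k, bList num p0 p1 k = ((List.range (k + 1)).map (bI num p0 p1)).reverse
  | 0 => by simp [bList, bI]
  | k + 1 => by
      have ih := bList_eq num p0 p1 k
      have hh : (bList num p0 p1 k).headD zI = bI num p0 p1 k := by
        rw [ih, List.range_succ, List.map_append, List.map_singleton, List.reverse_append]; simp
      simp only [bList, hh]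
      rw [ih, List.range_succ (n := k + 1), List.map_append, List.map_singleton, List.reverse_append]
      simp [bI]

/-- `PMem` of two tabulations. [folklore] -/
theorem pmem_map_range {S : ℕ} : ∀ (K : ℕ) {f : ℕ → ℝ} {F : ℕ → MI}, (∀ k, MI.mem S (f k) (F k)) →
    PMem S ((List.range K).map f) ((List.range K).map F)
  | 0, _, _, _ => by simpa using pmem_nil S
  | K + 1, f, F, h => by
      rw [List.range_succ_eq_map, List.map_cons, List.map_cons, List.map_map, List.map_map]
      exact pmem_cons (h 0) (pmem_map_range K (f := f ∘ Nat.succ) (F := F ∘ Nat.succ) fun k => h (k + 1))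

/-- THE SYNTHETIC-DIVISION IDENTITY `(p₀ + p₁ρ)·Σ_{k≤K} b_k ρ^k = Σ_{k≤K} ν_k ρ^k + p₁ b_K ρ^{K+1}`.
[folklore] -/
theorem sd_identity (ν : ℕ → ℝ) {p0 : ℝ} (p1 ρ : ℝ) (hp0 : p0 ≠ 0) : ∀ K : ℕ,
    (p0 + p1 * ρ) * ∑ k ∈ range (K + 1), bR ν p0 p1 k * ρ ^ k =
      ∑ k ∈ range (K + 1), ν k * ρ ^ k + p1 * bR ν p0 p1 K * ρ ^ (K + 1)
  | 0 => by
      have e : p0 * bR ν p0 p1 0 = ν 0 := by simp only [bR]; field_simp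
      simp only [zero_add, sum_range_one, pow_zero, mul_one, pow_one]
      linear_combination e
  | K + 1 => by
      have ih := sd_identity ν p1 ρ hp0 K
      have e : p0 * bR ν p0 p1 (K + 1) = ν (K + 1) - p1 * bR ν p0 p1 K := by
        simp only [bR]; field_simp
      rw [sum_range_succ _ (K + 1), sum_range_succ _ (K + 1)]
      linear_combination ih + ρ ^ (K + 1) * e

/-! ### C. One recursion entry -/

/-- `|x| ≤ absHi/S`-style helper: upper bound for `|x|·S`. [folklore] -/
def absHiI (I : MI) : ℤ := I.absHi

/-- The Taylor model of one entry `A_{n+1,j}(A+ρ)` from the models `Pp ∋ A_{n,j-1}`, `Pm ∋ A_{n,j+1}`: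
numerator coefficients `ν_k` (`k ≤ D+2`) of `γ⁺P⁺ + γ⁻P⁻` with `γ⁺ = c⁺(a+ρ)²`, `γ⁻ = c⁻(b+ρ)²`,
synthetic division by `p₀ + p₁ρ` to degree `D`, remainder folded into `b₀`
(`h = 2^{-e}`; the remainder numerator is rounded up through integer divisions, `+2`). [folklore] -/
def entryTM (e D : ℕ) (a cp b cm p0 p1 : ℚ) (Pp Pm : IPoly) : IPoly :=
  let num : ℕ → MI := fun k =>
    MI.add (conv3 (cp * a * a) (2 * cp * a) cp Pp k) (conv3 (cm * b * b) (2 * cm * b) cm Pm k)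
  let bs := bList num p0 p1 D
  let bD := bs.headD zI
  let r1 : ℤ := absHiI (MI.sub (num (D + 1)) (mulQ bD p1))
  let r2 : ℤ := absHiI (num (D + 2))
  let rn : ℤ := r1 / (2 ^ (e * (D + 1)) : ℤ) + r2 / (2 ^ (e * (D + 2)) : ℤ) + 2
  let m : ℚ := |p0| - |p1| / (2 ^ e : ℚ)
  let rem : ℤ := ⌈(rn : ℚ) / m⌉
  widen0 bs.reverse rem

/-- The pivot margin `m = |p₀| - |p₁| h`. [folklore] -/
def pivMargin (e : ℕ) (p0 p1 : ℚ) : ℚ := |p0| - |p1| / (2 ^ e : ℚ)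

/-- [folklore] -/
theorem headD_bList (num : ℕ → MI) (p0 p1 : ℚ) (D : ℕ) :
    (bList num p0 p1 D).headD zI = bI num p0 p1 D := by
  rw [bList_eq, List.range_succ, List.map_append, List.map_singleton, List.reverse_append]; simp

/-- [folklore] -/
theorem reverse_bList (num : ℕ → MI) (p0 p1 : ℚ) (D : ℕ) :
    (bList num p0 p1 D).reverse = (List.range (D + 1)).map (bI num p0 p1) := by
  rw [bList_eq, List.reverse_reverse]

/-- Integer division rounds down by less than one. [folklore] -/
theorem real_div_le_ediv_add_one (r : ℤ) {d : ℤ} (hd : 0 < d) :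
    (r : ℝ) / d ≤ ((r / d : ℤ) : ℝ) + 1 := by
  have h1 := Int.emod_add_mul_ediv r d
  have h2 := Int.emod_lt_of_pos r hd
  have hdR : (0 : ℝ) < d := by exact_mod_cast hd
  rw [div_le_iff₀ hdR]
  have e : (r : ℝ) = (r % d : ℤ) + (d : ℝ) * ((r / d : ℤ) : ℝ) := by exact_mod_cast h1.symm
  have h2R : ((r % d : ℤ) : ℝ) < d := by exact_mod_cast h2
  rw [e]; nlinarith

/-- `0 ≤ absHi`. [folklore] -/
theorem absHi_nonneg (I : MI) : 0 ≤ I.absHi := by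
  unfold MI.absHi; exact le_max_of_le_left (abs_nonneg _)

/-- **One recursion entry.** If `P⁺ ∋ f⁺`, `P⁻ ∋ f⁻` (degree ≤ `D`) on `|ρ| ≤ 2^{-e}`, the pivot margin
is positive and `(p₀ + p₁ρ) f(ρ) = c⁺(a+ρ)² f⁺(ρ) + c⁻(b+ρ)² f⁻(ρ)` on the cell, then
`entryTM ∋ f`. [folklore] -/
theorem tmem_entry {S e D : ℕ} {a cp b cm p0 p1 : ℚ} {Pp Pm : IPoly} {fp fm f : ℝ → ℝ}
    (hPp : TMem S ((1 : ℚ) / 2 ^ e) fp Pp) (hPm : TMem S ((1 : ℚ) / 2 ^ e) fm Pm)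
    (hlp : Pp.length ≤ D + 1) (hlm : Pm.length ≤ D + 1) (hm : 0 < pivMargin e p0 p1)
    (hrec : ∀ ρ : ℝ, |ρ| ≤ (((1 : ℚ) / 2 ^ e : ℚ) : ℝ) →
      ((p0 : ℝ) + p1 * ρ) * f ρ = (cp : ℝ) * (a + ρ) ^ 2 * fp ρ + (cm : ℝ) * (b + ρ) ^ 2 * fm ρ) :
    TMem S ((1 : ℚ) / 2 ^ e) f (entryTM e D a cp b cm p0 p1 Pp Pm) := by
  intro ρ hρ
  obtain ⟨asp, hasp, efp⟩ := hPp ρ hρ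
  obtain ⟨asm, hasm, efm⟩ := hPm ρ hρ
  have hh : ((((1 : ℚ) / 2 ^ e : ℚ)) : ℝ) = 1 / 2 ^ e := by push_cast; ring
  rw [hh] at hρ
  have h0 : (0 : ℝ) ≤ 1 / 2 ^ e := by positivity
  -- the numerator coefficients and their enclosures
  set num : ℕ → MI := fun k =>
    MI.add (conv3 (cp * a * a) (2 * cp * a) cp Pp k) (conv3 (cm * b * b) (2 * cm * b) cm Pm k) with hnum
  let ν : ℕ → ℝ := fun k =>
    conv3R (cp * a * a) (2 * cp * a) cp asp k + conv3R (cm * b * b) (2 * cm * b) cm asm k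
  have hν : ∀ k, MI.mem S (ν k) (num k) := fun k =>
    MI.mem_add (mem_conv3 hasp _ _ _ k) (mem_conv3 hasm _ _ _ k)
  have hlenp : asp.length ≤ D + 1 := hasp.length_eq ▸ hlp
  have hlenm : asm.length ≤ D + 1 := hasm.length_eq ▸ hlm
  -- the numerator polynomial is `pivot · f`
  have hN : ∑ k ∈ range (D + 3), ν k * ρ ^ k = ((p0 : ℝ) + p1 * ρ) * f ρ := by
    have e1 := sum_conv3R (cp * a * a) (2 * cp * a) cp asp ρ (K := D + 3) (by omega)
    have e2 := sum_conv3R (cm * b * b) (2 * cm * b) cm asm ρ (K := D + 3) (by omega)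
    rw [hrec ρ (by rw [hh]; exact hρ), efp, efm]
    simp only [ν, add_mul, sum_add_distrib, e1, e2]
    push_cast; ring
  -- pivot bounds
  have hmR : (0 : ℝ) < |(p0 : ℝ)| - |(p1 : ℝ)| / 2 ^ e := by
    have : ((pivMargin e p0 p1 : ℚ) : ℝ) = |(p0 : ℝ)| - |(p1 : ℝ)| / 2 ^ e := by
      simp only [pivMargin]; push_cast; ring
    rw [← this]; exact_mod_cast hm
  have hp0 : (p0 : ℝ) ≠ 0 := by
    intro h; rw [h, abs_zero] at hmR
    have : (0 : ℝ) ≤ |(p1 : ℝ)| / 2 ^ e := by positivity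
    linarith
  have hpiv : |(p0 : ℝ)| - |(p1 : ℝ)| / 2 ^ e ≤ |(p0 : ℝ) + p1 * ρ| := by
    have h1 : |(p0 : ℝ)| ≤ |(p0 : ℝ) + p1 * ρ| + |(p1 : ℝ) * ρ| := by
      have := abs_add_le ((p0 : ℝ) + p1 * ρ) (-(p1 * ρ))
      simpa [abs_neg] using this
    have h2 : |(p1 : ℝ) * ρ| ≤ |(p1 : ℝ)| / 2 ^ e := by
      rw [abs_mul, div_eq_mul_one_div]
      exact mul_le_mul_of_nonneg_left hρ (abs_nonneg _)
    linarith
  -- synthetic division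
  have hsd := sd_identity ν (p1 : ℝ) ρ hp0 D
  set B : ℝ := ∑ k ∈ range (D + 1), bR ν p0 p1 k * ρ ^ k with hB
  set δ : ℝ := f ρ - B with hδdef
  have hT : ((p0 : ℝ) + p1 * ρ) * δ =
      ρ ^ (D + 1) * ((ν (D + 1) - p1 * bR ν p0 p1 D) + ν (D + 2) * ρ) := by
    have e3 : ∑ k ∈ range (D + 3), ν k * ρ ^ k =
        ∑ k ∈ range (D + 1), ν k * ρ ^ k + ν (D + 1) * ρ ^ (D + 1) + ν (D + 2) * ρ ^ (D + 2) := by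
      rw [show D + 3 = D + 1 + 1 + 1 by omega, sum_range_succ, sum_range_succ]
    rw [hδdef, mul_sub, ← hN, e3, hsd]; ring
  -- scaled remainder bounds
  have hbD : MI.mem S (bR ν p0 p1 D) ((bList num p0 p1 D).headD zI) := by
    rw [headD_bList]; exact mem_bI hν p0 p1 D
  have hr1 := MI.abs_le_absHi (MI.mem_sub (hν (D + 1)) (mem_mulQ hbD p1))
  have hr2 := MI.abs_le_absHi (hν (D + 2))
  set r1 : ℤ := (MI.sub (num (D + 1)) (mulQ ((bList num p0 p1 D).headD zI) p1)).absHi with hr1def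
  set r2 : ℤ := (num (D + 2)).absHi with hr2def
  have hr1nn : (0 : ℝ) ≤ r1 := by exact_mod_cast absHi_nonneg _
  have hr2nn : (0 : ℝ) ≤ r2 := by exact_mod_cast absHi_nonneg _
  have hS0 : (0 : ℝ) ≤ S := by positivity
  -- |δ|·S·m ≤ r1 h^{D+1} + r2 h^{D+2}
  have hkey : |δ| * S * (|(p0 : ℝ)| - |(p1 : ℝ)| / 2 ^ e) ≤
      r1 * (1 / 2 ^ e) ^ (D + 1) + r2 * (1 / 2 ^ e) ^ (D + 2) := by
    have h1 : |δ| * (|(p0 : ℝ)| - |(p1 : ℝ)| / 2 ^ e) ≤ |δ| * |(p0 : ℝ) + p1 * ρ| :=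
      mul_le_mul_of_nonneg_left hpiv (abs_nonneg _)
    have h2 : |δ| * |(p0 : ℝ) + p1 * ρ| =
        |ρ| ^ (D + 1) * |(ν (D + 1) - p1 * bR ν p0 p1 D) + ν (D + 2) * ρ| := by
      rw [← abs_mul, mul_comm, hT, abs_mul, abs_pow]
    have h3 : |ρ| ^ (D + 1) ≤ (1 / 2 ^ e) ^ (D + 1) := pow_le_pow_left₀ (abs_nonneg _) hρ _
    have h4 : |(ν (D + 1) - p1 * bR ν p0 p1 D) + ν (D + 2) * ρ| * S ≤ r1 + r2 * (1 / 2 ^ e) := by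
      have h41 : |(ν (D + 1) - p1 * bR ν p0 p1 D) + ν (D + 2) * ρ| ≤
          |ν (D + 1) - bR ν p0 p1 D * p1| + |ν (D + 2)| * |ρ| := by
        rw [← abs_mul, mul_comm (p1 : ℝ)]; exact abs_add_le _ _
      have h42 : |ν (D + 2)| * |ρ| * S ≤ r2 * (1 / 2 ^ e) := by
        have := mul_le_mul hr2 hρ (abs_nonneg _) hr2nn
        calc |ν (D + 2)| * |ρ| * S = |ν (D + 2)| * S * |ρ| := by ring
          _ ≤ r2 * (1 / 2 ^ e) := this
      nlinarith [abs_nonneg ρ, abs_nonneg (ν (D + 2))]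
    have h5 : (0 : ℝ) ≤ |(ν (D + 1) - p1 * bR ν p0 p1 D) + ν (D + 2) * ρ| := abs_nonneg _
    calc |δ| * S * (|(p0 : ℝ)| - |(p1 : ℝ)| / 2 ^ e)
        = |δ| * (|(p0 : ℝ)| - |(p1 : ℝ)| / 2 ^ e) * S := by ring
      _ ≤ |δ| * |(p0 : ℝ) + p1 * ρ| * S := mul_le_mul_of_nonneg_right h1 hS0
      _ = |ρ| ^ (D + 1) * (|(ν (D + 1) - p1 * bR ν p0 p1 D) + ν (D + 2) * ρ| * S) := by rw [h2]; ring
      _ ≤ (1 / 2 ^ e) ^ (D + 1) * (r1 + r2 * (1 / 2 ^ e)) :=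
          mul_le_mul h3 h4 (by positivity) (by positivity)
      _ = r1 * (1 / 2 ^ e) ^ (D + 1) + r2 * (1 / 2 ^ e) ^ (D + 2) := by ring
  -- integer rounding of the numerator
  set rn : ℤ := r1 / (2 ^ (e * (D + 1)) : ℤ) + r2 / (2 ^ (e * (D + 2)) : ℤ) + 2 with hrn
  have hrnR : r1 * (1 / 2 ^ e : ℝ) ^ (D + 1) + r2 * (1 / 2 ^ e : ℝ) ^ (D + 2) ≤ rn := by
    have g1 := real_div_le_ediv_add_one r1 (d := 2 ^ (e * (D + 1))) (by positivity)
    have g2 := real_div_le_ediv_add_one r2 (d := 2 ^ (e * (D + 2))) (by positivity)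
    push_cast at g1 g2
    have f1 : (r1 : ℝ) * (1 / 2 ^ e : ℝ) ^ (D + 1) = (r1 : ℝ) / (2 : ℝ) ^ (e * (D + 1)) := by
      rw [pow_mul]; ring
    have f2 : (r2 : ℝ) * (1 / 2 ^ e : ℝ) ^ (D + 2) = (r2 : ℝ) / (2 : ℝ) ^ (e * (D + 2)) := by
      rw [pow_mul]; ring
    rw [f1, f2, hrn]; push_cast; linarith
  -- |δ|·S ≤ ⌈rn/m⌉
  set m : ℚ := |p0| - |p1| / (2 ^ e : ℚ) with hmdef
  have hmR' : ((m : ℚ) : ℝ) = |(p0 : ℝ)| - |(p1 : ℝ)| / 2 ^ e := by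
    simp only [hmdef]; push_cast; ring
  have hδ : |δ| * S ≤ ((⌈(rn : ℚ) / m⌉ : ℤ) : ℝ) := by
    have hmpos : (0 : ℝ) < ((m : ℚ) : ℝ) := by rw [hmR']; exact hmR
    have h1 : |δ| * S ≤ (rn : ℝ) / ((m : ℚ) : ℝ) := by
      rw [le_div_iff₀ hmpos, hmR']; exact hkey.trans hrnR
    have h2 : (rn : ℝ) / ((m : ℚ) : ℝ) ≤ ((⌈(rn : ℚ) / m⌉ : ℤ) : ℝ) := by
      have := Int.le_ceil ((rn : ℚ) / m)
      have h3 : (((rn : ℚ) / m : ℚ) : ℝ) ≤ ((⌈(rn : ℚ) / m⌉ : ℤ) : ℝ) := by exact_mod_cast this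
      simpa using h3
    exact h1.trans h2
  -- assemble
  have hPB : PMem S ((List.range (D + 1)).map (bR ν p0 p1)) (bList num p0 p1 D).reverse := by
    rw [reverse_bList]; exact pmem_map_range (D + 1) (mem_bI hν p0 p1)
  obtain ⟨bs, hbs, ebs⟩ := exists_widen0 hPB hδ ρ
  refine ⟨bs, ?_, ?_⟩
  · exact hbs
  · rw [ebs, evalR_map_range, ← hB, hδdef]; ring

/-! ### D. The rows `A_{n,·}(A+ρ)`, `n = 0 … nF` -/

/-- Linear pivot coefficients: `casimirPivot3D (A+ρ) ℓ (n+1) j = p₀ + p₁ ρ`. [cite: HogervorstRychkov2013, §3 eq. (3.9)] -/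
def p1Q (n : ℕ) : ℚ := 2 * ((n : ℚ) + 1)

/-- [cite: HogervorstRychkov2013, §3 eq. (3.9)] -/
def p0Q (A : ℚ) (ℓ n j : ℕ) : ℚ :=
  2 * ((n : ℚ) + 1) * A + ((n : ℚ) + 1) * ((n : ℚ) - 2) + (j : ℚ) * ((j : ℚ) + 1) - (ℓ : ℚ) * ((ℓ : ℚ) + 1)

/-- [cite: HogervorstRychkov2013, §3 eq. (3.9)] -/
theorem casimirPivot3D_eq (A : ℚ) (ℓ n j : ℕ) (ρ : ℝ) :
    casimirPivot3D ((A : ℝ) + ρ) ℓ (n + 1) j = (p0Q A ℓ n j : ℝ) + (p1Q n : ℝ) * ρ := by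
  simp only [casimirPivot3D, p0Q, p1Q]; push_cast; ring

/-- The exact linear model of the exceptional entry `A_{1,ℓ-1}(A+ρ) = (A+ρ-ℓ-1)ℓ/(2(2ℓ+1))`.
[cite: HogervorstRychkov2013, §2.2 eq. (2.30)] -/
def closedTM (S : ℕ) (A : ℚ) (ℓ : ℕ) : IPoly :=
  [ofRat S ((A - ℓ - 1) * ℓ / (2 * (2 * ℓ + 1))), ofRat S ((ℓ : ℚ) / (2 * (2 * ℓ + 1)))]

/-- [cite: HogervorstRychkov2013, §2.2 eq. (2.30)] -/
theorem tmem_closedTM (S : ℕ) (h : ℚ) (A : ℚ) {ℓ : ℕ} (hℓ : 1 ≤ ℓ) :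
    TMem S h (fun ρ => hrCoeff ((A : ℝ) + ρ) ℓ 1 (ℓ - 1)) (closedTM S A ℓ) := by
  intro ρ _
  refine ⟨[(((A - ℓ - 1) * ℓ / (2 * (2 * ℓ + 1)) : ℚ) : ℝ), ((((ℓ : ℚ) / (2 * (2 * ℓ + 1))) : ℚ) : ℝ)],
    pmem_cons (mem_ofRat S _) (pmem_cons (mem_ofRat S _) (pmem_nil S)), ?_⟩
  show hrCoeff ((A : ℝ) + ρ) ℓ 1 (ℓ - 1) = _
  rw [hrCoeff_one_pred_eq _ hℓ]
  simp only [evalR_cons, evalR_nil, mul_zero, add_zero]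
  have h2 : (2 : ℝ) * (2 * (ℓ : ℝ) + 1) ≠ 0 := by positivity
  push_cast
  field_simp
  ring

/-- `TMem` of the zero function by the empty model. [folklore] -/
theorem tmem_nil_zero (S : ℕ) (h : ℚ) : TMem S h (fun _ => (0 : ℝ)) [] :=
  fun _ _ => ⟨[], pmem_nil S, by simp⟩

/-- A function vanishing identically is enclosed by the empty model. [folklore] -/
theorem tmem_nil_of_eq_zero {S : ℕ} {h : ℚ} {f : ℝ → ℝ} (hf : ∀ ρ, f ρ = 0) : TMem S h f [] :=
  fun ρ _ => ⟨[], pmem_nil S, by simp [hf ρ]⟩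

/-- One entry of level `n+1` from the row of level `n`. [cite: HogervorstRychkov2013, §3 eq. (3.9)] -/
def stepEntry (S : ℕ) (A : ℚ) (ℓ e D n j : ℕ) (row : List IPoly) : IPoly :=
  if InDescendantRange ℓ (n + 1) j then
    if n = 0 ∧ j + 1 = ℓ then closedTM S A ℓ
    else
      entryTM e D (A + n + j - 1) (if j = 0 then 0 else (j : ℚ) / (2 * j - 1)) (A + n - j - 2)
        (((j : ℚ) + 1) / (2 * j + 3)) (p0Q A ℓ n j) (p1Q n)
        (if j = 0 then [] else row.getD (j - 1) []) (row.getD (j + 1) [])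
  else []

/-- The row of level `n+1` (`j = 0 … ℓ+n+1`). [cite: HogervorstRychkov2013, §3 eq. (3.9)] -/
def stepRow (S : ℕ) (A : ℚ) (ℓ e D n : ℕ) (row : List IPoly) : List IPoly :=
  vtab (ℓ + n + 2) fun j => stepEntry S A ℓ e D n j row

/-- Rows of levels `nF, nF-1, …, 0` (newest first). [cite: HogervorstRychkov2013, §3 eq. (3.9)] -/
def rows (S : ℕ) (A : ℚ) (ℓ e D : ℕ) : ℕ → List (List IPoly)
  | 0 => [vtab (ℓ + 1) fun j => if j = ℓ then [MI.ofInt S 1] else []]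
  | n + 1 =>
      let rs := rows S A ℓ e D n
      stepRow S A ℓ e D n (rs.headD []) :: rs

/-- The model of `A_{n,j}` read off `rows … nF` (`[]` = 0 outside the stored range). [folklore] -/
def rowEntry (rs : List (List IPoly)) (nF n j : ℕ) : IPoly := (rs.getD (nF - n) []).getD j []

/-- Kernel check: every non-exceptional pair on the descendant range has a positive pivot margin.
[folklore] -/
def pivOK (A : ℚ) (ℓ e nF : ℕ) : Bool :=
  rall nF fun n => rall (ℓ + n + 2) fun j =>
    decide (InDescendantRange ℓ (n + 1) j → ¬ (n = 0 ∧ j + 1 = ℓ) → 0 < pivMargin e (p0Q A ℓ n j) (p1Q n))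

/-- The pivot condition in `Prop` form. [folklore] -/
def PivCond (A : ℚ) (ℓ e nF : ℕ) : Prop :=
  ∀ n < nF, ∀ j < ℓ + n + 2, InDescendantRange ℓ (n + 1) j → ¬ (n = 0 ∧ j + 1 = ℓ) →
    0 < pivMargin e (p0Q A ℓ n j) (p1Q n)

/-- [folklore] -/
theorem pivCond_of_pivOK {A : ℚ} {ℓ e nF : ℕ} (h : pivOK A ℓ e nF = true) : PivCond A ℓ e nF := by
  intro n hn j hj
  have := of_rall (of_rall h hn) hj
  exact of_decide_eq_true this

/-- `getD` of a tabulated vector. [folklore] -/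
theorem getD_vtab {α : Type*} (N : ℕ) (f : ℕ → α) (d : α) (j : ℕ) :
    (vtab N f).getD j d = if j < N then f j else d := by
  unfold vtab
  rw [List.getD_eq_getElem?_getD, List.getElem?_map]
  split_ifs with hj
  · rw [List.getElem?_range hj]; rfl
  · rw [List.getElem?_eq_none (by simpa using Nat.le_of_not_lt hj)]; rfl

/-- `widen0` keeps lengths. [folklore] -/
theorem length_widen0_of_length {P : IPoly} {N : ℕ} (h : P.length = N + 1) (r : ℤ) :
    (widen0 P r).length = N + 1 := by
  match P, h with
  | _ :: Q, h => simpa [widen0] using h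

/-- [folklore] -/
theorem length_entryTM (e D : ℕ) (a cp b cm p0 p1 : ℚ) (Pp Pm : IPoly) :
    (entryTM e D a cp b cm p0 p1 Pp Pm).length = D + 1 := by
  simp only [entryTM]
  exact length_widen0_of_length (by rw [reverse_bList]; simp) _

/-- `γ⁺` as coefficient × square. [cite: HogervorstRychkov2013, §3 eq. (3.8)] -/
theorem hrGammaPlus_eq' (E : ℝ) (j' : ℕ) :
    hrGammaPlus E j' = ((j' : ℝ) + 1) / (2 * ((j' : ℝ) + 1) - 1) * (E + j') ^ 2 := by
  rw [show (2 : ℝ) * ((j' : ℝ) + 1) - 1 = 2 * (j' : ℝ) + 1 by ring, hrGammaPlus]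
  ring

/-- `γ⁻` as coefficient × square. [cite: HogervorstRychkov2013, §3 eq. (3.8)] -/
theorem hrGammaMinus_eq' (E : ℝ) (j' : ℕ) :
    hrGammaMinus E (j' + 1 + 1) = ((j' : ℝ) + 1 + 1) / (2 * ((j' : ℝ) + 1) + 3) * (E - j' - 3) ^ 2 := by
  rw [show (2 : ℝ) * ((j' : ℝ) + 1) + 3 = 2 * ((j' : ℝ) + 1 + 1) + 1 by ring, hrGammaMinus]
  push_cast
  ring

/-- `γ⁻_{E,1}`. [cite: HogervorstRychkov2013, §3 eq. (3.8)] -/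
theorem hrGammaMinus_one_eq' (E : ℝ) :
    hrGammaMinus E (0 + 1) = ((0 : ℝ) + 1) / (2 * (0 : ℝ) + 3) * (E - 0 - 2) ^ 2 := by
  rw [hrGammaMinus]; push_cast; ring

/-- Absolute lower bound of the linear pivot on the cell. [folklore] -/
theorem pivMargin_le_abs {e : ℕ} (p0 p1 : ℚ) {ρ : ℝ} (hρ : |ρ| ≤ 1 / 2 ^ e) :
    |(p0 : ℝ)| - |(p1 : ℝ)| / 2 ^ e ≤ |(p0 : ℝ) + p1 * ρ| := by
  have h1 : |(p0 : ℝ)| ≤ |(p0 : ℝ) + p1 * ρ| + |(p1 : ℝ) * ρ| := by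
    have := abs_add_le ((p0 : ℝ) + p1 * ρ) (-(p1 * ρ))
    simpa [abs_neg] using this
  have h2 : |(p1 : ℝ) * ρ| ≤ |(p1 : ℝ)| / 2 ^ e := by
    rw [abs_mul, div_eq_mul_one_div]
    exact mul_le_mul_of_nonneg_left hρ (abs_nonneg _)
  linarith

/-- **Soundness of one recursion step** (non-exceptional pair on the descendant range).
[cite: HogervorstRychkov2013, §3 eq. (3.9)] -/
theorem tmem_stepEntry_rec {S : ℕ} {A : ℚ} {ℓ e D n j : ℕ} {row : List IPoly}
    (hrow : ∀ j', TMem S ((1 : ℚ) / 2 ^ e) (fun ρ => hrCoeff ((A : ℝ) + ρ) ℓ n j') (row.getD j' []))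
    (hlen : ∀ j', (row.getD j' []).length ≤ D + 1)
    (hm : 0 < pivMargin e (p0Q A ℓ n j) (p1Q n)) :
    TMem S ((1 : ℚ) / 2 ^ e) (fun ρ => hrCoeff ((A : ℝ) + ρ) ℓ (n + 1) j)
      (entryTM e D (A + n + j - 1) (if j = 0 then 0 else (j : ℚ) / (2 * j - 1)) (A + n - j - 2)
        (((j : ℚ) + 1) / (2 * j + 3)) (p0Q A ℓ n j) (p1Q n)
        (if j = 0 then [] else row.getD (j - 1) []) (row.getD (j + 1) [])) := by
  have hh : ((((1 : ℚ) / 2 ^ e : ℚ)) : ℝ) = 1 / 2 ^ e := by push_cast; ring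
  by_cases hj : j = 0
  · subst hj
    simp only [if_true]
    refine tmem_entry (fp := fun _ => 0) (tmem_nil_zero S _) (hrow 1) (by simp) (hlen 1) hm ?_
    intro ρ hρ
    rw [hh] at hρ
    have hp : casimirPivot3D ((A : ℝ) + ρ) ℓ (n + 1) 0 ≠ 0 := by
      rw [casimirPivot3D_eq]
      have h1 := pivMargin_le_abs (p0Q A ℓ n 0) (p1Q n) hρ
      have h2 : ((pivMargin e (p0Q A ℓ n 0) (p1Q n) : ℚ) : ℝ) =
          |(p0Q A ℓ n 0 : ℝ)| - |(p1Q n : ℝ)| / 2 ^ e := by simp only [pivMargin]; push_cast; ring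
      have h3 : (0 : ℝ) < |(p0Q A ℓ n 0 : ℝ)| - |(p1Q n : ℝ)| / 2 ^ e := by rw [← h2]; exact_mod_cast hm
      intro h0; rw [h0, abs_zero] at h1; linarith
    have hrec := hrCoeff_succ_rec hp
    rw [casimirPivot3D_eq] at hrec
    show ((p0Q A ℓ n 0 : ℝ) + (p1Q n : ℝ) * ρ) * hrCoeff ((A : ℝ) + ρ) ℓ (n + 1) 0 = _
    rw [hrec, if_pos rfl, hrGammaMinus_one_eq']
    push_cast; ring
  · obtain ⟨j', rfl⟩ : ∃ j', j = j' + 1 := ⟨j - 1, by omega⟩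
    simp only [Nat.add_sub_cancel, if_neg (Nat.succ_ne_zero j')]
    refine tmem_entry (hrow j') (hrow (j' + 1 + 1)) (hlen j') (hlen (j' + 1 + 1)) hm ?_
    intro ρ hρ
    rw [hh] at hρ
    have hp : casimirPivot3D ((A : ℝ) + ρ) ℓ (n + 1) (j' + 1) ≠ 0 := by
      rw [casimirPivot3D_eq]
      have h1 := pivMargin_le_abs (p0Q A ℓ n (j' + 1)) (p1Q n) hρ
      have h2 : ((pivMargin e (p0Q A ℓ n (j' + 1)) (p1Q n) : ℚ) : ℝ) =
          |(p0Q A ℓ n (j' + 1) : ℝ)| - |(p1Q n : ℝ)| / 2 ^ e := by simp only [pivMargin]; push_cast; ring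
      have h3 : (0 : ℝ) < |(p0Q A ℓ n (j' + 1) : ℝ)| - |(p1Q n : ℝ)| / 2 ^ e := by
        rw [← h2]; exact_mod_cast hm
      intro h0; rw [h0, abs_zero] at h1; linarith
    have hrec := hrCoeff_succ_rec hp
    rw [casimirPivot3D_eq] at hrec
    show ((p0Q A ℓ n (j' + 1) : ℝ) + (p1Q n : ℝ) * ρ) * hrCoeff ((A : ℝ) + ρ) ℓ (n + 1) (j' + 1) = _
    rw [hrec, if_neg (Nat.succ_ne_zero j'), Nat.add_sub_cancel, hrGammaPlus_eq', hrGammaMinus_eq']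
    push_cast; ring

/-! ### E. Soundness of all rows -/

/-- The invariant: every stored entry encloses its coefficient and has degree `≤ D`. [folklore] -/
def RowsOK (S : ℕ) (A : ℚ) (ℓ e D nF : ℕ) (rs : List (List IPoly)) : Prop :=
  ∀ n ≤ nF, ∀ j, TMem S ((1 : ℚ) / 2 ^ e) (fun ρ => hrCoeff ((A : ℝ) + ρ) ℓ n j) (rowEntry rs nF n j) ∧
    (rowEntry rs nF n j).length ≤ D + 1

/-- [folklore] -/
theorem headD_eq_getD_zero {α : Type*} (l : List α) (d : α) : l.headD d = l.getD 0 d := by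
  cases l <;> rfl

/-- **Soundness of the Taylor-model recursion.** Under the pivot condition, for every `n ≤ nF` and
every `j`, `ρ ↦ A_{n,j}(A+ρ)` lies in the stored model on `|ρ| ≤ 2^{-e}`.
[cite: HogervorstRychkov2013, §3 eq. (3.9)] -/
theorem rows_ok {S : ℕ} (A : ℚ) (ℓ e D : ℕ) (hD : 1 ≤ D) :
    ∀ nF, PivCond A ℓ e nF → RowsOK S A ℓ e D nF (rows S A ℓ e D nF) := by
  intro nF
  induction nF with
  | zero =>
    intro _ n hn j
    obtain rfl : n = 0 := Nat.le_zero.mp hn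
    simp only [rowEntry, rows, Nat.sub_zero, List.getD_cons_zero, getD_vtab]
    by_cases hj : j < ℓ + 1
    · rw [if_pos hj]
      by_cases hjl : j = ℓ
      · subst hjl
        rw [if_pos rfl]
        refine ⟨fun ρ _ => ⟨[1], pmem_cons (by simpa using MI.mem_ofInt S 1) (pmem_nil S), by simp⟩, ?_⟩
        simp
      · rw [if_neg hjl]
        exact ⟨tmem_nil_of_eq_zero fun ρ => hrCoeff_zero_of_ne _ hjl, by simp⟩
    · rw [if_neg hj]
      have hjl : j ≠ ℓ := by omega
      exact ⟨tmem_nil_of_eq_zero fun ρ => hrCoeff_zero_of_ne _ hjl, by simp⟩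
  | succ nF ih =>
    intro hpc n hn j
    have hpc' : PivCond A ℓ e nF := fun n hn j hj => hpc n (Nat.lt_succ_of_lt hn) j hj
    have ih' := ih hpc'
    by_cases hle : n ≤ nF
    · -- an old row
      have e1 : rowEntry (rows S A ℓ e D (nF + 1)) (nF + 1) n j = rowEntry (rows S A ℓ e D nF) nF n j := by
        simp only [rowEntry, rows, show nF + 1 - n = (nF - n) + 1 by omega, List.getD_cons_succ]
      rw [e1]; exact ih' n hle j
    · -- the new row
      obtain rfl : n = nF + 1 := by omega
      set row : List IPoly := (rows S A ℓ e D nF).getD 0 [] with hrowdef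
      have hrow : ∀ j', TMem S ((1 : ℚ) / 2 ^ e) (fun ρ => hrCoeff ((A : ℝ) + ρ) ℓ nF j') (row.getD j' []) :=
        fun j' => by simpa [rowEntry, hrowdef] using (ih' nF le_rfl j').1
      have hlen : ∀ j', (row.getD j' []).length ≤ D + 1 :=
        fun j' => by simpa [rowEntry, hrowdef] using (ih' nF le_rfl j').2
      have e1 : rowEntry (rows S A ℓ e D (nF + 1)) (nF + 1) (nF + 1) j =
          (stepRow S A ℓ e D nF row).getD j [] := by
        simp only [rowEntry, rows, Nat.sub_self, List.getD_cons_zero, headD_eq_getD_zero, hrowdef]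
      rw [e1, stepRow, getD_vtab]
      by_cases hj : j < ℓ + nF + 2
      · rw [if_pos hj, stepEntry]
        by_cases hR : InDescendantRange ℓ (nF + 1) j
        · rw [if_pos hR]
          by_cases hx : nF = 0 ∧ j + 1 = ℓ
          · rw [if_pos hx]
            obtain ⟨rfl, hjℓ⟩ := hx
            have hℓ : 1 ≤ ℓ := by omega
            obtain rfl : j = ℓ - 1 := by omega
            exact ⟨tmem_closedTM S _ A hℓ, by simp [closedTM]; omega⟩
          · rw [if_neg hx]
            exact ⟨tmem_stepEntry_rec hrow hlen (hpc nF (Nat.lt_succ_self _) j hj hR hx),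
              (length_entryTM _ _ _ _ _ _ _ _ _ _).le⟩
        · rw [if_neg hR]
          exact ⟨tmem_nil_of_eq_zero fun ρ => hrCoeff_eq_zero_of_not_inDescendantRange _ hR, by simp⟩
      · rw [if_neg hj]
        have hR : ¬ InDescendantRange ℓ (nF + 1) j := by
          intro h; obtain ⟨_, h2, _⟩ := h; omega
        exact ⟨tmem_nil_of_eq_zero fun ρ => hrCoeff_eq_zero_of_not_inDescendantRange _ hR, by simp⟩

/-- **Kernel-facing corollary.** [cite: HogervorstRychkov2013, §3 eq. (3.9)] -/
theorem tmem_rows {S : ℕ} {A : ℚ} {ℓ e D nF : ℕ} (hD : 1 ≤ D) (hpiv : pivOK A ℓ e nF = true)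
    {n : ℕ} (hn : n ≤ nF) (j : ℕ) :
    TMem S ((1 : ℚ) / 2 ^ e) (fun ρ => hrCoeff ((A : ℝ) + ρ) ℓ n j) (rowEntry (rows S A ℓ e D nF) nF n j) :=
  (rows_ok A ℓ e D hD nF (pivCond_of_pivOK hpiv) n hn j).1

/-- Degree bound of the stored models. [folklore] -/
theorem length_rowEntry_le {S : ℕ} {A : ℚ} {ℓ e D nF : ℕ} (hD : 1 ≤ D) (hpiv : pivOK A ℓ e nF = true)
    {n : ℕ} (hn : n ≤ nF) (j : ℕ) : (rowEntry (rows S A ℓ e D nF) nF n j).length ≤ D + 1 :=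
  (rows_ok A ℓ e D hD nF (pivCond_of_pivOK hpiv) n hn j).2

end HRTM

end Literature.MathematicalPhysics.QuantumFieldTheory.ConformalBootstrap3D
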